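import Literature.AnabelianGeometry.SemiGraphs.TemperedGroups
import HarnessLib

/-!
# Relative temp-slimness from relative slimness of a completion ([SemiAnbd] Prop. 3.6 (iv), the
# "formal" step)

Mochizuki, *Semi-graphs of anabelioids*, Publ. RIMS **42** (2006), §3, proof of Proposition 3.6
(iv) (manuscript p. 40) [cite: MochizukiSemiAnbd2006, Prop 3.6(iv) p.40]: "the remainder of assertion
(iv) [a locally open morphism induces a RELATIVELY TEMP-SLIM morphism of temperoids] follows, in light
of the injection of assertion (iii) [`π₁^temp(G) ↪ π̂₁(G)`], formally from Corollary 2.7, (ii)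
[relative slimness of `π̂₁(G') → π̂₁(G)`]."  This proof-only file isolates that formal step as plain
topological group theory: if `φ : Π₁ → Π₂` is compatible with continuous homomorphisms
`ι₁ : Π₁ → P₁`, `ι₂ : Π₂ → P₂`, `φ̂ : P₁ → P₂` (`φ̂ ∘ ι₁ = ι₂ ∘ φ`), `ι₂` is injective, `P₂` is Hausdorff,
and the centraliser in `P₂` of the closure of `φ̂(ι₁(U))` is trivial for every open subgroup
`U ⊆ Π₁` (which is what relative slimness of `φ̂` gives once `ι₁(U)` has open closure, e.g. for the
profinite completion), then `φ` is relatively temp-slim (Definition 3.4 (ii)).  No definitions;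
nothing here takes a side on [IUTchIII] Cor. 3.12.
-/

namespace Literature.AnabelianGeometry.SemiGraphs

open Topology

universe u

variable {G₁ G₂ P₁ P₂ : Type u} [Group G₁] [TopologicalSpace G₁] [Group G₂] [TopologicalSpace G₂]
  [Group P₁] [TopologicalSpace P₁] [Group P₂] [TopologicalSpace P₂]

/-- An element commuting with every element of a subset of a Hausdorff topological group commutes
with every element of its closure. [folklore] -/
private theorem commute_of_mem_closure [IsTopologicalGroup P₂] [T2Space P₂] {A : Set P₂} {z : P₂}
    (hz : ∀ a ∈ A, a * z = z * a) {x : P₂} (hx : x ∈ closure A) : x * z = z * x := by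
  have hclosed : IsClosed {a : P₂ | a * z = z * a} :=
    isClosed_eq (continuous_id.mul continuous_const) (continuous_const.mul continuous_id)
  exact (hclosed.closure_subset_iff.mpr hz) hx

/-- **The formal step of [SemiAnbd] Prop. 3.6 (iv)**: relative temp-slimness of `φ : G₁ → G₂`
(Def. 3.4 (ii): `Z_{G₂}(φ(U)) = 1` for all open `U ⊆ G₁`) follows from the triviality of the
centralisers, in a Hausdorff group `P₂` into which `G₂` injects compatibly (`φ̂ ∘ ι₁ = ι₂ ∘ φ`), of the
closures of the images `φ̂(ι₁(U))`. [cite: MochizukiSemiAnbd2006, Prop 3.6(iv) p.40] -/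
theorem isRelativelyTempSlim_of_completion [IsTopologicalGroup P₂] [T2Space P₂] (φ : G₁ →ₜ* G₂)
    (ι₁ : G₁ →ₜ* P₁) (ι₂ : G₂ →ₜ* P₂) (φhat : P₁ →ₜ* P₂) (hcomm : ∀ x, φhat (ι₁ x) = ι₂ (φ x))
    (hι₂ : Function.Injective ι₂)
    (hslim : ∀ U : Subgroup G₁, IsOpen (U : Set G₁) → ∀ z : P₂,
      (∀ y ∈ closure (φhat '' (ι₁ '' (U : Set G₁))), y * z = z * y) → z = 1) :
    IsRelativelyTempSlim φ := by
  refine ⟨fun U hU => ?_⟩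
  rw [Subgroup.eq_bot_iff_forall]
  intro z hz
  rw [Subgroup.mem_centralizer_iff] at hz
  apply hι₂
  rw [map_one]
  refine hslim U hU (ι₂ z) fun y hy => commute_of_mem_closure (fun a ha => ?_) hy
  obtain ⟨_, ⟨u, hu, rfl⟩, rfl⟩ := ha
  rw [hcomm, ← map_mul, ← map_mul]
  congr 1
  exact hz (φ u) ⟨u, hu, rfl⟩


/-- **[SemiAnbd] Prop. 3.6 (iv), clause 2, in bridge form**: `φ : G₁ → G₂` is relatively temp-slim as
soon as it extends to a continuous `φ̂ : P₁ → P₂` along `ι₁ : G₁ → P₁`, `ι₂ : G₂ → P₂` with `P₂`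
Hausdorff, `ι₂` injective ("the injection of assertion (iii)", `π₁^temp ↪ π̂₁`), the closures of the
images `ι₁(U)` of open subgroups open in `P₁` (the profinite completion), and `φ̂` relatively slim on
open subgroups of `P₁` ("Corollary 2.7, (ii)").  The three inputs are exactly what the presentation
bridge `π₁^temp(G) ↪ π̂₁(G)` has to supply. [cite: MochizukiSemiAnbd2006, Prop 3.6(iv) p.40] -/
theorem isRelativelyTempSlim_of_relativelySlim_completion [IsTopologicalGroup P₁] [IsTopologicalGroup P₂]
    [T2Space P₂]
    (φ : G₁ →ₜ* G₂) (ι₁ : G₁ →ₜ* P₁) (ι₂ : G₂ →ₜ* P₂) (φhat : P₁ →ₜ* P₂)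
    (hcomm : ∀ x, φhat (ι₁ x) = ι₂ (φ x)) (hι₂ : Function.Injective ι₂)
    (hopen : ∀ U : Subgroup G₁, IsOpen (U : Set G₁) →
      IsOpen ((U.map ι₁.toMonoidHom).topologicalClosure : Set P₁))
    (hslim : ∀ V : Subgroup P₁, IsOpen (V : Set P₁) →
      Subgroup.centralizer ((V.map φhat.toMonoidHom : Subgroup P₂) : Set P₂) = ⊥) :
    IsRelativelyTempSlim φ := by
  refine isRelativelyTempSlim_of_completion φ ι₁ ι₂ φhat hcomm hι₂ fun U hU z hz => ?_
  have hbot := hslim _ (hopen U hU)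
  rw [Subgroup.eq_bot_iff_forall] at hbot
  refine hbot z ?_
  rw [Subgroup.mem_centralizer_iff]
  rintro _ ⟨v, hv, rfl⟩
  -- `v` lies in the closure of `ι₁(U)`, so `φ̂ v` lies in the closure of `φ̂(ι₁(U))`
  apply hz
  have hv' : v ∈ closure ((U.map ι₁.toMonoidHom : Subgroup P₁) : Set P₁) := hv
  have himage : (φhat : P₁ → P₂) '' ((U.map ι₁.toMonoidHom : Subgroup P₁) : Set P₁) =
      φhat '' (ι₁ '' (U : Set G₁)) := by
    ext y
    simp only [Set.mem_image, Subgroup.coe_map, MonoidHom.coe_coe, ContinuousMonoidHom.coe_toMonoidHom,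
      exists_exists_and_eq_and]
  rw [← himage]
  exact image_closure_subset_closure_image φhat.continuous ⟨v, hv', rfl⟩

end Literature.AnabelianGeometry.SemiGraphs
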